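import Literature.Probability.LatticeModels.KCFamilyBounds
import Literature.Probability.LatticeModels.LatticeToContinuumCross
import Literature.Probability.LatticeModels.LatticeToContinuumHolomorphic
import HarnessLib

/-!
# The plain branch of the spin fermion along a nice family: precompactness and holomorphy of limits

Topic `Literature/Probability/LatticeModels`. Chelkak–Hongler–Izyurov 2015, §3.5 (proof of
Thm 2.16, first paragraph): once the primitives `H_δ` are bounded on compacts away from `a`, the
functions `ϑ(δ)^{-1} F_δ` are equicontinuous (Thm 3.12), subsequential limits exist by the diagonal
process and are holomorphic spinors. For a nice family of Kadanoff–Ceva data (`KCFamilyBounds.lean`)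
this file completes the lattice hypotheses of the observable-independent continuum chain for the
plain branch `F_δ = kcObs` on the slit domain `Ω ∖ seamRay a` (off the seam the section is an
honest s-holomorphic bond function):

* `KCFamily.IsNice.isSHolAt_near` (s-holomorphicity at the corners of the sites near a compact off
  the seam ray, eventually), `IsNice.latticeCrossHyp`, `IsNice.cr` (Cauchy–Riemann at sites and
  faces);
* the packaged consequences: **`IsNice.exists_sqrt_bound`**, **`IsNice.exists_equicont_bound`**,
  **`IsNice.exists_cross_bound`**, **`IsNice.exists_subseq_limit`** (on `Ω ∖ seamRay a`) and
  **`IsNice.differentiableOn_of_limit`** (every such limit is holomorphic on `Ω ∖ seamRay a`).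

Everything is proved; no named fact.

## References

* D. Chelkak, C. Hongler, K. Izyurov, Ann. of Math. 181 (2015): Thm 3.12 and §3.5
  [ChelkakHonglerIzyurovAnnals2015].
* S. Smirnov, Ann. of Math. 172 (2010), §5 [Smirnov2010].
-/

noncomputable section

namespace Literature.Probability.LatticeModels

open Filter _root_.Topology Metric Set Finset SimpleGraph

namespace KCFamily

variable {𝓕 : KCFamily} {Ω : Set ℂ} {a : ℂ}

/-- **s-holomorphicity near a compact off the seam ray**: eventually in the mesh, at every corner of
every site within lattice sup-distance `2` of a site with mesh point in `K`. [cite: ChelkakHonglerIzyurovAnnals2015, Prop. 2.4] -/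
theorem IsNice.isSHolAt_near (h : 𝓕.IsNice Ω a) {K : Set ℂ} (hK : IsCompact K) (hKΩ : K ⊆ Ω \ seamRay a) :
    ∀ᶠ δ in 𝓝[>] (0 : ℝ), ∀ x : Site 2, meshPoint δ x ∈ K → ∀ y ∈ latticeBall x 2, ∀ k : Fin 4, IsSHolAt (𝓕.obs Ω δ) (y, k) := by
  have hKa : K ⊆ Ω \ {a} := fun z hz => ⟨(hKΩ hz).1, fun hza => (hKΩ hz).2 (hza ▸ mem_seamRay_self a)⟩
  obtain ⟨ρb, hρb, hbulk⟩ := h.bulk K hKa hK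
  obtain ⟨ρs, hρs, hseam⟩ := h.seam K hKΩ hK
  set ρ := min ρb ρs with hρ
  have hρ0 : 0 < ρ := by positivity
  have hsmall : ∀ᶠ δ in 𝓝[>] (0 : ℝ), δ < ρ / 8 := nhdsWithin_le_nhds (Iio_mem_nhds (by positivity))
  have h3 : ∀ᶠ δ in 𝓝[>] (0 : ℝ), 0 < δ := self_mem_nhdsWithin
  filter_upwards [h.adj, h.cuts, hbulk, hseam, hsmall, h3] with δ hadj hcuts hb hs hδs hδ0 x hx y hy k
  have hR : δ * (2 * (3 : ℤ)) ≤ ρ := by push_cast; linarith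
  have hKb := kcBulk_of_clauses (𝓕 := 𝓕) (Ω := Ω) hδ0.le (x := x) (R := 3) hR
    (fun y hy => hb x y hx (hy.trans (min_le_left _ _))) (fun y hy => hs x y hx (hy.trans (min_le_right _ _)))
  have hy3 : ∀ z ∈ latticeBall y 1, z ∈ latticeBall x 3 := by
    intro z hz; rw [mem_latticeBall] at hy hz ⊢; intro i; have := hy i; have := hz i; constructor <;> linarith
  have hy0 : y ∈ latticeBall y 0 := by rw [mem_latticeBall]; intro i; constructor <;> linarith
  exact hKb.isSHolAt_kcObs hcuts hadj (discreteDomainGraph_le_zdGraph Ω δ) (hy3 y (latticeBall_subset (by norm_num) hy0))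
    (hy3 _ (add_cornerUnit_mem_latticeBall hy0 2)) (hy3 _ (add_cornerUnit_mem_latticeBall hy0 3)) k

/-- **The lattice cross hypothesis for the plain branch.** [cite: Smirnov2010, proof of Lemma 3.6] -/
theorem IsNice.latticeCrossHyp (h : 𝓕.IsNice Ω a) {K : Set ℂ} (hK : IsCompact K) (hKΩ : K ⊆ Ω \ seamRay a) :
    LatticeCrossHyp (𝓕.obs Ω) K := by
  filter_upwards [h.isSHolAt_near hK hKΩ] with δ hS x hx
  have hx0 : x ∈ latticeBall x 0 := by rw [mem_latticeBall]; intro i; constructor <;> linarith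
  have s0 := hS x hx x (latticeBall_subset (by norm_num) hx0) 0
  have s2 := hS x hx (x + cornerUnit 1) (latticeBall_subset (by norm_num) (add_cornerUnit_mem_latticeBall hx0 1)) 2
  have key := norm_sub_le_of_isSHolAt s0 s2
  have e2 : cSrc (x + cornerUnit 1, (2 : Fin 4)) = cSrc (x + cornerUnit 1 + cornerUnit 2, 0) := by
    rw [cSrc_two, show (2 : Fin 4) = 0 + 2 from rfl, cornerUnit_add_two, sub_eq_add_neg]
  rwa [e2] at key

/-- **Cauchy–Riemann at the sites and faces near a compact off the seam ray.** [cite: Smirnov2010, Remark 3.3] -/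
theorem IsNice.cr (h : 𝓕.IsNice Ω a) {K : Set ℂ} (hK : IsCompact K) (hKΩ : K ⊆ Ω \ seamRay a) :
    ∀ᶠ δ in 𝓝[>] (0 : ℝ), ∀ x : Site 2, meshPoint δ x ∈ K → CRVertex (𝓕.obs Ω δ) x ∧ CRFace (𝓕.obs Ω δ) x := by
  filter_upwards [h.isSHolAt_near hK hKΩ] with δ hS x hx
  have hx0 : x ∈ latticeBall x 0 := by rw [mem_latticeBall]; intro i; constructor <;> linarith
  refine ⟨crVertex_of_isSHolAt fun k => hS x hx x (latticeBall_subset (by norm_num) hx0) k,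
    crFace_of_isSHolAt fun j => hS x hx _ ?_ j⟩
  have := add_cornerOff_mem_latticeBall hx0 j
  exact latticeBall_subset (by norm_num) this

/-- **`|F_δ| ≤ M √δ` on compacts off the seam ray.** [cite: ChelkakHonglerIzyurovAnnals2015, Thm 3.12 (3.12)] -/
theorem IsNice.exists_sqrt_bound (h : 𝓕.IsNice Ω a) (hΩ : IsOpen Ω) {K : Set ℂ} (hK : IsCompact K) (hKΩ : K ⊆ Ω \ seamRay a) :
    ∃ M : ℝ, 0 ≤ M ∧ ∀ᶠ δ in 𝓝[>] (0 : ℝ), ∀ x : Site 2, meshPoint δ x ∈ K → ∀ i : Fin 4, (i = 0 ∨ i = 1) →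
      ‖𝓕.obs Ω δ (cSrc (x, i))‖ ≤ M * Real.sqrt δ := by
  obtain ⟨ρ, hρ, M, hM, hsup⟩ := h.latticeSupHyp hΩ hK hKΩ
  exact exists_sqrt_bound_of_latticeSupHyp hρ (kcSupConst_nonneg M) hsup

/-- **`√δ`-equicontinuity on compacts off the seam ray.** [cite: ChelkakHonglerIzyurovAnnals2015, Thm 3.12 (3.13)] -/
theorem IsNice.exists_equicont_bound (h : 𝓕.IsNice Ω a) (hΩ : IsOpen Ω) {K : Set ℂ} (hK : IsCompact K) (hKΩ : K ⊆ Ω \ seamRay a) :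
    ∃ L : ℝ, 0 ≤ L ∧ ∀ᶠ δ in 𝓝[>] (0 : ℝ), ∀ x x' : Site 2, meshPoint δ x ∈ K → meshPoint δ x' ∈ K →
      ‖𝓕.obs Ω δ (cSrc (x', 0)) - 𝓕.obs Ω δ (cSrc (x, 0))‖ ≤ L * Real.sqrt δ * (dist (meshPoint δ x') (meshPoint δ x) + δ) := by
  obtain ⟨M, hM0, hM⟩ := h.exists_sqrt_bound hΩ hK hKΩ
  obtain ⟨ρ, hρ, M', hM', hlip⟩ := h.latticeLipHyp hΩ hK hKΩ
  have hC' : 0 ≤ 8 * topGradConst * kcSupConst M' := by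
    have := topGradConst_pos; have := kcSupConst_nonneg M'; positivity
  exact exists_equicont_bound_of_hyps hρ hC' hM0 hlip hM

/-- **`|F_δ(vertical) - F_δ(horizontal)| = O(δ√δ)` on compacts off the seam ray.** [cite: Smirnov2010, §5] -/
theorem IsNice.exists_cross_bound (h : 𝓕.IsNice Ω a) (hΩ : IsOpen Ω) {K : Set ℂ} (hK : IsCompact K) (hKΩ : K ⊆ Ω \ seamRay a) :
    ∃ L : ℝ, 0 ≤ L ∧ ∀ᶠ δ in 𝓝[>] (0 : ℝ), ∀ x : Site 2, meshPoint δ x ∈ K →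
      ‖𝓕.obs Ω δ (cSrc (x, 1)) - 𝓕.obs Ω δ (cSrc (x, 0))‖ ≤ L * δ * Real.sqrt δ := by
  obtain ⟨ρ, hρ, M', hM', hlip⟩ := h.latticeLipHyp hΩ hK hKΩ
  have hC' : 0 ≤ 8 * topGradConst * kcSupConst M' := by
    have := topGradConst_pos; have := kcSupConst_nonneg M'; positivity
  exact exists_cross_bound_of_hyps hρ hC' (h.latticeCrossHyp hK hKΩ) hlip

/-- **Precompactness of the plain branch on the slit domain**: every sequence of meshes `δ_n → 0⁺`
has a subsequence along which `δ^{-1/2} F_δ` converges uniformly on compacts of `Ω ∖ seamRay a` to a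
function continuous there. [cite: ChelkakHonglerIzyurovAnnals2015, §3.5 (diagonal process)] -/
theorem IsNice.exists_subseq_limit (h : 𝓕.IsNice Ω a) (hΩ : IsOpen Ω) {s : ℕ → ℝ} (hs : Tendsto s atTop (𝓝[>] (0 : ℝ))) :
    ∃ φ : ℕ → ℕ, StrictMono φ ∧ ∃ g : ℂ → ℂ, ContinuousOn g (Ω \ seamRay a) ∧
      ∀ K ⊆ Ω \ seamRay a, IsCompact K → TendstoUniformlyOn (fun k z => scaledEdgeFamily (𝓕.obs Ω) s (φ k) z) g atTop K :=
  exists_subseq_limit_of_bounds (hΩ.sdiff (isClosed_seamRay a))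
    (fun K hKΩ hK => by
      obtain ⟨M, hM0, hM⟩ := h.exists_sqrt_bound hΩ hK hKΩ
      exact ⟨M, hM0, hM.mono fun δ hδ x hx => hδ x hx 0 (Or.inl rfl)⟩)
    (fun K hKΩ hK => h.exists_equicont_bound hΩ hK hKΩ) hs

/-- **Subsequential limits of the plain branch are holomorphic on the slit domain.** [cite: ChelkakHonglerIzyurovAnnals2015, §3.5 ("f̃ is a holomorphic spinor")] -/
theorem IsNice.differentiableOn_of_limit (h : 𝓕.IsNice Ω a) (hΩ : IsOpen Ω) {s : ℕ → ℝ} (hs : Tendsto s atTop (𝓝[>] (0 : ℝ)))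
    {g : ℂ → ℂ} (hg : ContinuousOn g (Ω \ seamRay a))
    (hconv : ∀ K ⊆ Ω \ seamRay a, IsCompact K → TendstoUniformlyOn (scaledEdgeFamily (𝓕.obs Ω) s) g atTop K) :
    DifferentiableOn ℂ g (Ω \ seamRay a) :=
  differentiableOn_of_limit_of_hyps (hΩ.sdiff (isClosed_seamRay a)) (fun K hKΩ hK => h.cr hK hKΩ)
    (fun K hKΩ hK => by
      obtain ⟨L, -, hL⟩ := h.exists_cross_bound hΩ hK hKΩ
      exact ⟨L, hL⟩) hs hg hconv

end KCFamily

end Literature.Probability.LatticeModels
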